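import Literature.IUT.LogVolume.TensorPacketOrbitContent
import HarnessLib

/-!
# The log-volume of the hull of the (Ind2)-orbit of a bounded region:
# `log μ̄(hull(⋃_{g ∈ Ind2} g·M)) = −m·log p + log μ̄(hull(log_p(R_I^×)))` (Dupuy–Hilado §4.9–4.12;
# [IUTchIV] Prop. 1.4)

VOLUME form of `TensorPacketOrbitContent.lean` for the cell's REAL tensor packet `V = ⊗_{ℚ_p} k_i`: the hull
commutes with unit scalars (`packetHull_smul_of_isUnit`, `packetHull_zpow_smul`: `hull(p^n·S) = p^n·hull(S)`),
`hull(log_p(R_I^×))` is admissible (`packetAdm_packetHull_logPacket`, trapped between `log_p(R_I^×)` and the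
translate `⊗h_i·(R_I)^∼` of [IUTchIV] Prop. 1.2 (i)), hence Dupuy–Hilado's "Mochizuki normalisation"
(`packetLogμ_ppow_smul`) gives `log μ̄(hull(p^m·log_p(R_I^×))) = −m·log p + log μ̄(hull(log_p(R_I^×)))`
(`packetLogμ_packetHull_zpow_smul_logPacket`) and, with `exists_packetHull_orbit_eq_zpow`, the headline
**`exists_packetLogμ_packetHull_orbit_eq`**: for every bounded region `M ⊄ {0}` with content `m`,

  `log μ̄(hull(⋃_{g ∈ Ind2} g·M)) = −m·log p + log μ̄(hull(log_p(R_I^×)))`, and this hull is admissible.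

So at one summand of the real packet, with the FULL (Ind2) group, the Θ-hull volume is an explicit affine
function of ONE integer (the content of the (Ind1)-union of the bare Θ-regions w.r.t. `log_p(R_I^×)`); the
[IUTchIV] Thm. 1.10 Step (v) upper bound (tree: `realPrimePacket_stepV`, `thetaHull_bound`) is thereby matched
by an exact formula, as `HOME/skel/FORK-REAL-MODEL.md` §4 wanted ("Budget_actual = Budget up to rounding").
[cite: DupuyHilado2025, §4.9, §4.12] [cite: Mochizuki2012, IUTchIV Prop. 1.4 (i) p. 13] The bookkeeping of `m`
against `ord(t)` and the Prop. 1.2 sandwich is the consumer's; no side is taken on [IUTchIII] Cor. 3.12;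
(Ind2)/the hull are the tree's typings [claim: Mochizuki2012, status: disputed]. PROOF-ONLY file.
-/

noncomputable section

open Set Module
open scoped Pointwise TensorProduct

namespace Literature.IUT.LogVolume

variable (p : ℕ) [Fact p.Prime]
variable {I : Type} [Fintype I] [DecidableEq I] [Nonempty I]
variable (k : I → Type) [∀ i, NontriviallyNormedField (k i)] [∀ i, NormedAlgebra ℚ_[p] (k i)]
  [∀ i, IsUltrametricDist (k i)] [∀ i, ProperSpace (k i)]

/-! ## The hull commutes with unit scalars -/

omit [Fintype I] [DecidableEq I] [Nonempty I] [∀ i, IsUltrametricDist (k i)] [∀ i, ProperSpace (k i)] in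
/-- **`hull(u·S) = u·hull(S)` for a unit `u` of `V`**: multiplication by `u` is an `(R_I)^∼`-linear automorphism of
the commutative ring `V`, and spans are transported along linear automorphisms.
[cite: DupuyHilado2025, Rmk. 4.12.1 p. 16] -/
theorem packetHull_smul_of_isUnit {u : PacketAlgebra p k} (hu : IsUnit u) (S : Set (PacketAlgebra p k)) :
    packetHull p k (u • S) = u • packetHull p k S := by
  obtain ⟨u, rfl⟩ := hu
  -- multiplication by the unit `u` as an `(R_I)^∼`-linear automorphism of `V`
  let e : PacketAlgebra p k ≃ₗ[normalizedPacket p k] PacketAlgebra p k :=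
    { toFun := fun x => (u : PacketAlgebra p k) * x
      invFun := fun x => (↑u⁻¹ : PacketAlgebra p k) * x
      map_add' := fun x y => mul_add _ x y
      map_smul' := fun r x => by
        rw [RingHom.id_apply, Subring.smul_def, Subring.smul_def, smul_eq_mul, smul_eq_mul, mul_left_comm]
      left_inv := fun x => by simp only [← mul_assoc, Units.inv_mul, one_mul]
      right_inv := fun x => by simp only [← mul_assoc, Units.mul_inv, one_mul] }
  have he : ∀ T : Set (PacketAlgebra p k), (u : PacketAlgebra p k) • T = e '' T := fun T => by
    rw [← Set.image_smul]; rfl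
  have h1 : Submodule.span (normalizedPacket p k) (e '' S) =
      Submodule.map e.toLinearMap (Submodule.span (normalizedPacket p k) S) := by
    rw [← Submodule.span_image]; rfl
  rw [packetHull_apply, packetHull_apply, packetSpan, packetSpan, he, he, h1, Submodule.map_coe]
  rfl

omit [Fintype I] [DecidableEq I] [Nonempty I] [∀ i, IsUltrametricDist (k i)] [∀ i, ProperSpace (k i)] in
/-- **`hull(p^n·S) = p^n·hull(S)`** (`n ∈ ℤ`, scalar `p^n ∈ ℚ_p`). [cite: DupuyHilado2025, Rmk. 4.12.1 p. 16] -/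
theorem packetHull_zpow_smul (n : ℤ) (S : Set (PacketAlgebra p k)) :
    packetHull p k (((p : ℚ_[p]) ^ n) • S) = ((p : ℚ_[p]) ^ n) • packetHull p k S := by
  rw [← ppow_smul_set_eq, ← ppow_smul_set_eq]
  exact packetHull_smul_of_isUnit p k (isUnit_ppow p k n) S

/-! ## `hull(log_p(R_I^×))` is admissible; its scalar multiples -/

/-- **`hull(log_p(R_I^×))` is admissible**: it contains the admissible `log_p(R_I^×)` and lies in the (hull-closed,
admissible) translate `⊗h_i·(R_I)^∼` of [IUTchIV] Prop. 1.2 (i). [cite: Mochizuki2012, IUTchIV Prop. 1.2 (i) p. 10]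
[cite: DupuyHilado2025, §4.12] -/
theorem packetAdm_packetHull_logPacket :
    PacketAdm p k (packetHull p k (logPacket p k : Set (PacketAlgebra p k))) := by
  obtain ⟨h, hh, hsub⟩ := exists_logPacket_subset_purePacket_smul_normalizedPacket p k
  exact packetAdm_packetHull p k (dEquiv_purePacket_ne_zero p k hh) (packetAdm_logPacket p k)
    Set.Subset.rfl hsub

/-- **`log μ̄(hull(p^m·log_p(R_I^×))) = −m·log p + log μ̄(hull(log_p(R_I^×)))`** (Dupuy–Hilado's "Mochizuki
normalised" `log μ̄(p^n·A) = −n·log p + log μ̄(A)`). [cite: DupuyHilado2025, Rmk. 3.5.4, §4.12] -/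
theorem packetLogμ_packetHull_zpow_smul_logPacket (m : ℤ) :
    packetLogμ p k (packetHull p k (((p : ℚ_[p]) ^ m) • (logPacket p k : Set (PacketAlgebra p k)))) =
      -(m * Real.log p) + packetLogμ p k (packetHull p k (logPacket p k : Set (PacketAlgebra p k))) := by
  rw [packetHull_zpow_smul, ← ppow_smul_set_eq, packetLogμ_ppow_smul p k m (packetAdm_packetHull_logPacket p k)]

/-- `hull(p^m·log_p(R_I^×))` is admissible. [cite: DupuyHilado2025, §4.12] -/
theorem packetAdm_packetHull_zpow_smul_logPacket (m : ℤ) :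
    PacketAdm p k (packetHull p k (((p : ℚ_[p]) ^ m) • (logPacket p k : Set (PacketAlgebra p k)))) := by
  rw [packetHull_zpow_smul]
  exact packetAdm_const_smul p k (zpow_ne_zero m (Nat.cast_ne_zero.mpr (Fact.out : p.Prime).ne_zero))
    (packetAdm_packetHull_logPacket p k)

/-! ## The log-volume of the hull of an (Ind2)-orbit -/

/-- **`log μ̄(hull(⋃_{g ∈ Ind2} g·M)) = −m·log p + log μ̄(hull(log_p(R_I^×)))`** for a region
`M ⊆ p^m·log_p(R_I^×)` containing a vector outside `p^{m+1}·log_p(R_I^×)`; and that hull is admissible.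
[cite: DupuyHilado2025, §4.9, §4.12] -/
theorem packetLogμ_packetHull_orbit_eq {M : Set (PacketAlgebra p k)} {x : PacketAlgebra p k} {m : ℤ}
    (hxM : x ∈ M) (hx : x ∉ ((p : ℚ_[p]) ^ (m + 1)) • (logPacket p k : Set (PacketAlgebra p k)))
    (hM : M ⊆ ((p : ℚ_[p]) ^ m) • (logPacket p k : Set (PacketAlgebra p k))) :
    PacketAdm p k (packetHull p k (⋃ g : indTwo p k, g • M)) ∧
      packetLogμ p k (packetHull p k (⋃ g : indTwo p k, g • M)) =
        -(m * Real.log p) + packetLogμ p k (packetHull p k (logPacket p k : Set (PacketAlgebra p k))) := by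
  rw [packetHull_orbit_eq_zpow p k hxM hx hM]
  exact ⟨packetAdm_packetHull_zpow_smul_logPacket p k m, packetLogμ_packetHull_zpow_smul_logPacket p k m⟩

/-- **Headline**: for EVERY bounded region `M ⊄ {0}` of the packet there is an integer `m` (its content:
`M ⊆ p^m·log_p(R_I^×)`, `M ⊄ p^{m+1}·log_p(R_I^×)`) such that the hull of the (Ind2)-orbit of `M` is admissible
with `log μ̄ = −m·log p + log μ̄(hull(log_p(R_I^×)))`. [cite: DupuyHilado2025, §4.9, §4.12] -/
theorem exists_packetLogμ_packetHull_orbit_eq {M : Set (PacketAlgebra p k)} (hMb : IsPsiBounded p k M)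
    (hM0 : ∃ x ∈ M, x ≠ 0) :
    ∃ m : ℤ, M ⊆ ((p : ℚ_[p]) ^ m) • (logPacket p k : Set (PacketAlgebra p k)) ∧
      ¬ M ⊆ ((p : ℚ_[p]) ^ (m + 1)) • (logPacket p k : Set (PacketAlgebra p k)) ∧
      PacketAdm p k (packetHull p k (⋃ g : indTwo p k, g • M)) ∧
      packetLogμ p k (packetHull p k (⋃ g : indTwo p k, g • M)) =
        -(m * Real.log p) + packetLogμ p k (packetHull p k (logPacket p k : Set (PacketAlgebra p k))) := by
  obtain ⟨m, hm, hm1⟩ := exists_content p k hMb hM0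
  obtain ⟨x, hxM, hx⟩ := Set.not_subset.mp hm1
  exact ⟨m, hm, hm1, packetLogμ_packetHull_orbit_eq p k hxM hx hm⟩

/-- **Monotonicity in the content**: a region of content `m` and one of content `m' ≥ m` have orbit hulls whose
log-volumes differ by exactly `(m' − m)·log p ≥ 0` in favour of the SMALLER content — in particular two bounded
nonzero regions of the same content have orbit hulls of the same log-volume. [cite: DupuyHilado2025, §4.9, §4.12] -/
theorem packetLogμ_packetHull_orbit_sub {M M' : Set (PacketAlgebra p k)} {x x' : PacketAlgebra p k} {m m' : ℤ}
    (hxM : x ∈ M) (hx : x ∉ ((p : ℚ_[p]) ^ (m + 1)) • (logPacket p k : Set (PacketAlgebra p k)))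
    (hM : M ⊆ ((p : ℚ_[p]) ^ m) • (logPacket p k : Set (PacketAlgebra p k)))
    (hxM' : x' ∈ M') (hx' : x' ∉ ((p : ℚ_[p]) ^ (m' + 1)) • (logPacket p k : Set (PacketAlgebra p k)))
    (hM' : M' ⊆ ((p : ℚ_[p]) ^ m') • (logPacket p k : Set (PacketAlgebra p k))) :
    packetLogμ p k (packetHull p k (⋃ g : indTwo p k, g • M)) -
        packetLogμ p k (packetHull p k (⋃ g : indTwo p k, g • M')) = (m' - m) * Real.log p := by
  rw [(packetLogμ_packetHull_orbit_eq p k hxM hx hM).2, (packetLogμ_packetHull_orbit_eq p k hxM' hx' hM').2]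
  ring

end Literature.IUT.LogVolume

end
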